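import Summits.NavierStokesRegularity.NavierStokesRegularity.Theorems.LerayQuarterDissipationFiniteDissipationLiouvilleUnidirectionalFloor
import HarnessLib

/-!
# Crux `FiniteDissipationLiouville` (stmt-NavierStokesRegularity-22144): the COHERENCE PORTRAIT —
# the crux is equivalent to its restriction to TOTALLY INCOHERENT profiles

Theorems file of route `LerayQuarterDissipation` (lead prover ns-lqd-lead g8; `--supports` the
crux, line `birth`). Navier–Stokes regularity is NOT proved by anything here; no summit is.

One kernel statement collecting the coherence family of this generation
(`…VorticityAlignment`, `…PlanarityFloor`, `…UnidirectionalFloor`): to prove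
`FiniteDissipationLiouville` it suffices to exclude the singular members of `𝒟_{C,K}` which, for
some `δ > 0` and at EVERY instant `t < 0`, carry in the parabolic ball `B(0, δ⁻¹√(−t))`
(a) two points of scaled vorticity `> δ` with vorticity directions `δ`-apart modulo sign,
(b) for every unit direction `e` a point with `(−t)‖∂ₑ w‖ > δ`, and
(c) two points of scaled speed `> δ` with velocity directions `δ`-apart modulo sign
(`finiteDissipationLiouville_iff_incoherent`); every other member is regular by the three one-slice
leaves. Portrait fact only: no discretely self-similar or wandering profile with genuinely
three-dimensional vorticity is removed.
-/

noncomputable section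

-- the summit and its single sub-problem share the name (CONVENTIONS §1), as in every Theorems file
set_option linter.dupNamespace false

namespace Summit.NavierStokesRegularity.NavierStokesRegularity.Theorems.FiniteDissipationLiouville.CoherencePortrait

open MeasureTheory Set Filter Topology Metric Function
open Literature.Analysis Literature.Analysis.FluidPDE
open Summit.NavierStokesRegularity.NavierStokesRegularity.Theorems.FiniteDissipationLiouville
open scoped ENNReal NNReal RealInnerProductSpace

/-- **Total incoherence of a finite-dissipation Type-I singularity** (one `δ = δ(C,K) > 0` for
the three floors): every SINGULAR member of `𝒟_{C,K}` carries, at every instant, the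
direction-oscillation floor, the planarity floor and the unidirectionality floor on
`B(0, δ⁻¹√(−t))`. [cite: KochNadirashviliSereginSverak2009, §4 (arXiv:0709.3599 p. 8)] [cite: GigaMiura2011, Thm 2.10 (HUPS preprint #956 p. 10)] -/
theorem incoherence_floors_of_singular : ∀ (C K : ℝ), ∃ δ > 0,
    ∀ (w : ℝ → EuclideanSpace ℝ (Fin 3) → EuclideanSpace ℝ (Fin 3)),
      IsTypeIAncientMild C w →
      (∀ s : ℝ, s < 0 → ∫⁻ x, ‖fderiv ℝ (w s) x‖ₑ ^ 2 ≤ ENNReal.ofReal (K / Real.sqrt (-s))) →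
      (∀ ρ > 0, ∀ M : ℝ, ∃ t ∈ Ioo (-(ρ ^ 2)) (0 : ℝ),
        ∃ x ∈ ball (0 : EuclideanSpace ℝ (Fin 3)) ρ, M < ‖w t x‖) →
      ∀ t < 0,
        (∃ x ∈ ball (0 : EuclideanSpace ℝ (Fin 3)) (δ⁻¹ * Real.sqrt (-t)),
          ∃ y ∈ ball (0 : EuclideanSpace ℝ (Fin 3)) (δ⁻¹ * Real.sqrt (-t)),
            δ < (-t) * ‖curl (w t) x‖ ∧ δ < (-t) * ‖curl (w t) y‖ ∧
            δ < ‖vorticityDirection (curl (w t)) x - vorticityDirection (curl (w t)) y‖ ∧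
            δ < ‖vorticityDirection (curl (w t)) x + vorticityDirection (curl (w t)) y‖) ∧
        (∀ e : EuclideanSpace ℝ (Fin 3), ‖e‖ = 1 →
          ∃ x ∈ ball (0 : EuclideanSpace ℝ (Fin 3)) (δ⁻¹ * Real.sqrt (-t)),
            δ < (-t) * ‖fderiv ℝ (w t) x e‖) ∧
        (∃ x ∈ ball (0 : EuclideanSpace ℝ (Fin 3)) (δ⁻¹ * Real.sqrt (-t)),
          ∃ y ∈ ball (0 : EuclideanSpace ℝ (Fin 3)) (δ⁻¹ * Real.sqrt (-t)),
            δ < Real.sqrt (-t) * ‖w t x‖ ∧ δ < Real.sqrt (-t) * ‖w t y‖ ∧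
            δ < ‖‖w t x‖⁻¹ • w t x - ‖w t y‖⁻¹ • w t y‖ ∧
            δ < ‖‖w t x‖⁻¹ • w t x + ‖w t y‖⁻¹ • w t y‖) := by
  intro C K
  obtain ⟨δ₁, hδ₁, h₁⟩ := VorticityAlignment.directionOscillation_floor_of_singular C K
  obtain ⟨δ₂, hδ₂, h₂⟩ := Planarity.planarity_floor_of_singular C K
  obtain ⟨δ₃, hδ₃, h₃⟩ := Unidirectional.unidirectionality_floor_of_singular C K
  -- the common tolerance
  set δ : ℝ := min δ₁ (min δ₂ δ₃) with hδ_def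
  have hδ : 0 < δ := lt_min hδ₁ (lt_min hδ₂ hδ₃)
  have hle₁ : δ ≤ δ₁ := min_le_left _ _
  have hle₂ : δ ≤ δ₂ := (min_le_right _ _).trans (min_le_left _ _)
  have hle₃ : δ ≤ δ₃ := (min_le_right _ _).trans (min_le_right _ _)
  -- a smaller tolerance has a larger ball and weaker floors
  have hball : ∀ {δ' : ℝ}, δ ≤ δ' → ∀ {t : ℝ},
      ball (0 : EuclideanSpace ℝ (Fin 3)) (δ'⁻¹ * Real.sqrt (-t)) ⊆
        ball (0 : EuclideanSpace ℝ (Fin 3)) (δ⁻¹ * Real.sqrt (-t)) := by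
    intro δ' hδ' t
    exact ball_subset_ball (mul_le_mul_of_nonneg_right
      ((inv_le_inv₀ (hδ.trans_le hδ') hδ).2 hδ') (Real.sqrt_nonneg _))
  refine ⟨δ, hδ, fun w hw hlaw hsing t ht => ⟨?_, ?_, ?_⟩⟩
  · obtain ⟨x, hx, y, hy, a, b, c, d⟩ := h₁ w hw hlaw hsing t ht
    exact ⟨x, hball hle₁ hx, y, hball hle₁ hy, hle₁.trans_lt a, hle₁.trans_lt b, hle₁.trans_lt c,
      hle₁.trans_lt d⟩
  · intro e he
    obtain ⟨x, hx, a⟩ := h₂ w hw hlaw hsing t ht e he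
    exact ⟨x, hball hle₂ hx, hle₂.trans_lt a⟩
  · obtain ⟨x, hx, y, hy, a, b, c, d⟩ := h₃ w hw hlaw hsing t ht
    exact ⟨x, hball hle₃ hx, y, hball hle₃ hy, hle₃.trans_lt a, hle₃.trans_lt b, hle₃.trans_lt c,
      hle₃.trans_lt d⟩

/-- **The crux is equivalent to its restriction to TOTALLY INCOHERENT profiles**: it suffices to
exclude singular members of `𝒟_{C,K}` carrying, for some `δ > 0` and at every instant, the three
coherence floors (vorticity direction, planarity, velocity direction) on `B(0, δ⁻¹√(−t))`.
[cite: GigaMiura2011, Thm 2.10 (HUPS preprint #956 p. 10)] -/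
theorem finiteDissipationLiouville_iff_incoherent :
    Summit.NavierStokesRegularity.NavierStokesRegularity.Theses.LerayQuarterDissipation.FiniteDissipationLiouville ↔
    ∀ (C K : ℝ) (ū : ℝ → EuclideanSpace ℝ (Fin 3) → EuclideanSpace ℝ (Fin 3)),
      IsTypeIAncientMild C ū →
      (∀ s : ℝ, s < 0 → ∫⁻ x, ‖fderiv ℝ (ū s) x‖ₑ ^ 2 ≤ ENNReal.ofReal (K / Real.sqrt (-s))) →
      (∃ δ > 0, ∀ t < 0,
        (∃ x ∈ ball (0 : EuclideanSpace ℝ (Fin 3)) (δ⁻¹ * Real.sqrt (-t)),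
          ∃ y ∈ ball (0 : EuclideanSpace ℝ (Fin 3)) (δ⁻¹ * Real.sqrt (-t)),
            δ < (-t) * ‖curl (ū t) x‖ ∧ δ < (-t) * ‖curl (ū t) y‖ ∧
            δ < ‖vorticityDirection (curl (ū t)) x - vorticityDirection (curl (ū t)) y‖ ∧
            δ < ‖vorticityDirection (curl (ū t)) x + vorticityDirection (curl (ū t)) y‖) ∧
        (∀ e : EuclideanSpace ℝ (Fin 3), ‖e‖ = 1 →
          ∃ x ∈ ball (0 : EuclideanSpace ℝ (Fin 3)) (δ⁻¹ * Real.sqrt (-t)),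
            δ < (-t) * ‖fderiv ℝ (ū t) x e‖) ∧
        (∃ x ∈ ball (0 : EuclideanSpace ℝ (Fin 3)) (δ⁻¹ * Real.sqrt (-t)),
          ∃ y ∈ ball (0 : EuclideanSpace ℝ (Fin 3)) (δ⁻¹ * Real.sqrt (-t)),
            δ < Real.sqrt (-t) * ‖ū t x‖ ∧ δ < Real.sqrt (-t) * ‖ū t y‖ ∧
            δ < ‖‖ū t x‖⁻¹ • ū t x - ‖ū t y‖⁻¹ • ū t y‖ ∧
            δ < ‖‖ū t x‖⁻¹ • ū t x + ‖ū t y‖⁻¹ • ū t y‖)) →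
      ¬ (∀ r > 0, ∀ M : ℝ, ∃ t ∈ Ioo (-(r ^ 2)) (0 : ℝ),
        ∃ x ∈ ball (0 : EuclideanSpace ℝ (Fin 3)) r, M < ‖ū t x‖) := by
  unfold Summit.NavierStokesRegularity.NavierStokesRegularity.Theses.LerayQuarterDissipation.FiniteDissipationLiouville
  refine ⟨fun h C K ū hū hlaw _ => h C K ū hū hlaw, fun h C K ū hū hlaw hsing => ?_⟩
  obtain ⟨δ, hδ, hfl⟩ := incoherence_floors_of_singular C K
  exact h C K ū hū hlaw ⟨δ, hδ, fun t ht => hfl ū hū hlaw hsing t ht⟩ hsing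

end Summit.NavierStokesRegularity.NavierStokesRegularity.Theorems.FiniteDissipationLiouville.CoherencePortrait

end
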